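import Mathlib
import HarnessLib
import HarnessLib.Audit
import Summits.BirchSwinnertonDyer.Statement
import Summits.BirchSwinnertonDyer.BirchSwinnertonDyer.Theorems.EisensteinPrimesInputs
import Summits.BirchSwinnertonDyer.BirchSwinnertonDyer.Theorems.Rank1ResidualX1Defs
import Literature.NumberTheory.EllipticCurves.GreenbergVatsal2000.NonPrimitivePAdicLFunction
import Summits.BirchSwinnertonDyer.Rank1Residual.X11b.BDPRoute
import Summits.BirchSwinnertonDyer.Rank1Residual.X2.ClassClosureO9
import HarnessLib.Audit.Status.Attr

/-!
Route: EisensteinPrimes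

# Route EisensteinPrimes — Rank ≤ 1 BSD(E,p) at the residual Eisenstein pairs X1 ∪ X2 from five
named inputs, one per ladder row

It suffices to show X = X₁ ∧ X₂ ∧ X₃ ∧ X₄ ∧ X₅ (+ the published inputs P): X₁ =
`GoodLatticeBDPValue` (Keller–Yin Thm 3.0.8: the anticyclotomic main conjecture IMC2 with the BDP
value at the trivial character for the GOOD lattice at an anomalous Eisenstein prime — ladder row
A1, class X1 type A, analytic rank 1), X₂ = `MazurMCOnCellB` (Mazur's cyclotomic main conjecture at
every X2b pair: E[p] reducible, p multiplicative, analytic rank 0, Greenberg–Vatsal parity failing —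
row A10), X₃ = `BSDpOnCellC` (Miller's BSD(E,p) at every X2c pair: E[p] reducible, p multiplicative,
analytic rank 1 — row B11, = `X2.TargetC`), X₄ = `MazurMCOnX1RankZero` (Mazur's main conjecture at
every X1 pair of analytic rank 0 — row A3), X₅ = `SchneiderOnX1TypeB` (non-degeneracy of the
canonical p-adic height on X1 type B, rank 1 — row A2 / rider I1). Then the rung-K5 leaf
`EisensteinPrimes := BSDpOnClassX1 ∧ X2.Target` — the p-part of BSD (Miller Def. 1.1) at every
residual Eisenstein pair of analytic rank ≤ 1 in the classes X1 (good anomalous reducible) and X2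
(multiplicative reducible) — follows by the class assemblies already in the tree. This is the
D-0059/D-0061 ledger form of the bsd-eis cell's FULL-BSD RANK ≤ 1 programme (TARGET.md v1.8.11): one
crux per ladder row, so that what closes K5 is a ledger item, not a folder.
Lean: `GoodLatticeBDPValue ∧ MazurMCOnCellB ∧ BSDpOnCellC ∧ MazurMCOnX1RankZero ∧ SchneiderOnX1TypeB
∧ PublishedInputs`

## Assembly
Certified in glue.lean (`closes`, sorry-free; all six hypotheses consumed; the body applies the
Theorems-side kernel certificate
`Theorems.EisensteinPrimesInputs.eisensteinPrimes_of_inputs_of_targetC` (p405898, cgshw g3; the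
display-shaped `eisensteinPrimes_of_inputs` p405443 is its special case), which imports the
`Rank1Residual/` class assemblies a route file may not import directly). X1 conjunct `BSDpOnClassX1`
(∀ W p, ClassX1 W p → analyticRank ≤ 1 → BSDp W p): analytic rank 0 →
`Rank1ResidualX1Defs.bsdp_of_classX1_of_analyticRank_eq_zero` fed by MazurMCOnX1RankZero and three
published inputs; analytic rank 1, excluded middle on `GVPar W p`: type B →
`X1.bsdp_of_typeBRankOne_of_schneider` fed by SchneiderOnX1TypeB, GV Thm 1.3, Schneider 1985,
Perrin-Riou and the PROVED σ-existence `X1.PadicSigmaThree.mazur_tate_sigma_exists_odd_holds`; type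
A → Keller–Yin Theorem A on the class `X1.KellerYinTheoremA.forall_bsdp_classX1_typeA_rankOne`
(p403478) fed by GoodLatticeBDPValue and eleven published inputs. X2 conjunct `X2.Target` (= TargetA
∧ TargetB ∧ TargetC): `X2.target_of_targets` fed by `targetA_of_published`,
`targetB_of_missingInputB` (MazurMCOnCellB as `MissingInputB`), BSDpOnCellC (as `TargetC`) and the
multiplicative published inputs (GV multiplicative λ/μ, Wuthrich Thm 16, Stein–Wuthrich 6.1 ×2 +
heights ×2, GZK, modularity, Greenberg–Stevens, Hoffstein–Luo, Gross–Zagier I.7.3). Pure logic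
otherwise (`Nat.le_one_iff_eq_zero_or_eq_one`, `by_cases`).

CLOSES_TARGET: closes rung K5 of BirchSwinnertonDyer: Summit.BirchSwinnertonDyer.Rank1Residual.Eisenstein.EisensteinPrimes (D-0061; not the summit Statement) — the deciding theorem of this route concludes that registered leaf instead of the Statement decl `BirchSwinnertonDyer` (class rung: servable and labelled, never counted as concluding the summit Statement).

Rationale: WHY THIS LINE. At a residual Eisenstein pair (E, p) — p odd, E[p] reducible, analytic rank ≤ 1, p
good anomalous (class X1) or multiplicative (class X2) — the p-part of BSD is the value/leading term
of a main conjecture whose Eisenstein congruence is the obstruction and the resource at once: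
Greenberg–Vatsal 2000 (GreenbergVatsal2000) settle the μ = 0 / "gvpar" side, Kato 2004 + Wuthrich
2014 (Kato2004Asterisque, Wuthrich2014) give one divisibility everywhere, and the tree already
assembles BSD(E,p) on each sub-cell from ONE missing input: Keller–Yin's anticyclotomic Theorem
3.0.8 at the good lattice for X1 type A rank 1 (KellerYin2024 with the torsion-free control of
CastellaGrossiLeeSkinner2022; `forall_bsdp_classX1_typeA_rankOne`, p403478), Schneider's height
non-degeneracy for X1 type B rank 1 (`X1.bsdp_of_typeBRankOne_of_schneider`, σ-existence proved),
Mazur's main conjecture for X1 rank 0 and X2b (`bsdp_of_classX1_of_analyticRank_eq_zero`,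
`X2.targetB_of_missingInputB`), and the rank-one anticyclotomic display for X2c
(`X2.targetC_of_rankOneDisplay_of_targetB`, with Hsieh2014 / CastellaGrossiSkinner2025 behind it);
X2a is proved from published inputs (`X2.targetA_of_published`). Imported areas: cyclotomic and
anticyclotomic Iwasawa theory (main conjectures, control theorems), p-adic Waldspurger/BDP formulas
(BertoliniDarmonPrasanna2013), p-adic heights (Schneider1985, PerrinRiou1987), and per-pair
certified numerics for the congruence-transfer lines under `MazurMCOnCellB` (route G, TARGET §1.2).
No prior ledger route targets the reducible residue: the open BSD routes (DefiniteTheta, FrozenTwin,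
KatoTransfer, …) all carry a surjectivity / irreducibility hypothesis at p; the negatives index has
no statement on reducible pairs.

RANKED CRUXES. #2 GoodLatticeBDPValue (crux) — Keller–Yin 2024 Theorem 3.0.8 in the form the tree
names `thm308_imc2_bdpValue_goodLattice_OPEN`: for E/ℚ with a rational p-isogeny at a good anomalous
(Eisenstein) prime p and an admissible imaginary quadratic K, the anticyclotomic main conjecture
IMC2 holds integrally for the GOOD lattice and the BDP p-adic L-function takes the predicted value
at the trivial character (the input h308 of Keller–Yin Theorem A on class X1 type A, rank 1; ladder
row A1, 7 892 cells ‖ 8 604 pairs). PREPRINT (arXiv v2); everything else Theorem A needs is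
published and typed. [difficulty: L] (why it might fail: Preprint theorem: the good-lattice IMC2
needs torsion-free anticyclotomic control at an anomalous p (CGLS 2022 Thm 5.1.1 shape) and a μ = 0
input for the BDP L-function at Eisenstein p; a gap in KY v2 §3 at p = 3 or for p | a_p − 1 twice
would void it.) [KellerYin2024, CastellaGrossiLeeSkinner2022, BertoliniDarmonPrasanna2013,
CastellaGrossiSkinner2025]
#3 MazurMCOnCellB (crux) — Mazur's cyclotomic main conjecture (characteristic ideal of the p-Selmer
group over ℚ_∞ = p-adic L-function, with the split-multiplicative trivial-zero clause) at EVERY X2b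
pair: E[p] reducible, p of multiplicative reduction, analytic rank 0, Greenberg–Vatsal parity
failing (so μ > 0 is allowed on the displayed member). Ladder row A10 (83 split + 44 non-split cells
at p = 3 in the N9 atlas; all p in the statement). Per pair it is reached by congruence transfer
from a λ-minimal relative (route G, 59 displays in the kernel modulo certificates) or by the
non-split cyclotomic argument CGS §§1–3, 6 at the p-new point (R9-WORK); class-wide it is
Greenberg's μ-conjecture in the Eisenstein case plus one divisibility. STRUCTURE (rev 19, kernel,
referee g85 PASS): #3 ⟺ #4 modulo ONE display — the Heegner-index identity over K at p ∥ N in both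
rank orientations, filed as the support item HeegnerIndexIdentityKRankOne
(`…Theorems.EisensteinPrimesMazurMCOnCellBTwistbackDisplay.mazurMCOnCellB_iff_bsdpOnCellC_of_indexIdentities`,
p623836 §3; over ℚ
`…Theorems.EisensteinPrimesMazurMCOnCellBTwistback.mazurMCOnCellB_iff_bsdpOnCellC_of_displays`,
p622525 §5); the display-free remainder of #3 (the μ-FREE «twist-back» road to row A10) is Schneider
on X2c ∩ GVPar (support item SchneiderOnX2CellCGV) + the split exceptional leading term
`X2.O9.ExceptionalLeadingTermAt`
(`…TwistbackRemainder….mazurMCOnCellB_of_rankZeroDisplay_of_schneider_of_exceptionalLeadingTerm`,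
p623232). [difficulty: open-problem] (why it might fail: Class-wide it contains Greenberg's
μ-conjecture for reducible E[p] at multiplicative p (print: families only, Bellaïche–Pollack); 16/83
split cells at p = 3 have no congruent relative, hence no typed road; the non-split cyclotomic input
at p = 3 is not in print (KLZ17 §7.2: p ≥ 5).) [GreenbergVatsal2000, Wuthrich2014,
Kato2004Asterisque, SkinnerUrban2014, GreenbergLNM1716, BellaichePollack2019,
CastellaGrossiSkinner2025, KingsLoefflerZerbes2017]
#4 BSDpOnCellC (crux) — BSD(E,p) in Miller's form (`BSDp W p`) for every X2c pair — E[p] reducible,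
p multiplicative, analytic rank 1 — i.e. the tree's `X2.TargetC` (`∀ W p, X2.CellC W p → BSDp W p`,
Cells.lean:133): ladder row B11 in PARTITION currency (O9: 12 665 cells, 12 106 at p = 3). Eligible
closing lines: the rank-one display road (`X2.targetC_of_rankOneDisplay_of_targetB`: stubs =
`X2.RankOneDisplay` — a Hsieh-frame BDP p-adic L-function with its value at the trivial character
and the anticyclotomic IMC equality on the tree side — + crux 3 at the partner) and the direct BSDp
roads (cgshw's (b1) non-split Hsieh road `X2/NonsplitHalvesOnTree` p404431/p404695 with declared
residuals c1 `HsiehFrameResidualAt`, c2 `NonsplitBDPValueOnTree`, c3 `NonsplitIMCEqOnTree`; its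
split analogue with the partner input). [structure, rev 19: ⟺ #3 modulo HeegnerIndexIdentityKRankOne
+ FACTS (p623836 §3) — see #3 and TWO-LAYER PLAN] [deps: MazurMCOnCellB] [difficulty: open-problem]
(why it might fail: Each road needs a BDP formula + anticyclotomic IMC at p ‖ N, E[p] reducible:
Hsieh 2014 Thm A gives values only (μ = 0 = Thm B needs ρ̄ irreducible; its BDP comparison at p ∣ N
is unprinted below 5), CGS 2025 is at good p, KLZ17 §7.2 only for p ≥ 5; `HsiehFrameResidualAt` may
fail (no admissible K).) [Hsieh2014, CastellaGrossiSkinner2025, KingsLoefflerZerbes2017,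
BurungaleSkinnerTianWan2024, BertoliniDarmonPrasanna2013, Hida1988AIF]
#5 MazurMCOnX1RankZero (crux) — Mazur's cyclotomic main conjecture at every X1 pair (p good ordinary
anomalous, E[p] reducible) of analytic rank 0 (ladder row A3; on the Greenberg–Vatsal side it is GV
Thm 1.3, so the content is the type-A = ¬gvpar rows, where the μ-invariant of the displayed member
is positive and GV's argument does not apply). [difficulty: open-problem] (why it might fail: On
type A the displayed member has μ > 0 and no published argument gives the reverse divisibility
(Kato/Wuthrich give ⊆ only; Skinner–Urban needs irreducible E[p]); it is Greenberg's μ-conjecture +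
λ-equality in the anomalous Eisenstein case, open since Greenberg–Vatsal 2000 §1.)
[GreenbergVatsal2000, Kato2004Asterisque, Wuthrich2014, SkinnerUrban2014, KellerYin2024,
GreenbergLNM1716]
#6 SchneiderOnX1TypeB (crux) — Schneider's conjecture on X1 type B in analytic rank 1: for every
such pair (E, p) and every p-adic height datum that IS the canonical (Mazur–Tate / Schneider)
cyclotomic height — sigma formula on admissible points — the p-adic regulator is non-zero (ladder
row A2, 1 307 cells; the rider I1 of the Schneider cell). Consumed by
`X1.bsdp_of_typeBRankOne_of_schneider` together with GV Thm 1.3, Schneider 1985 and Perrin-Riou's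
rank-one leading terms (published) and the σ-existence theorem proved in the tree. [difficulty:
open-problem] (why it might fail: It is p-adic height non-degeneracy in rank 1 (ĥ_p(P) ≠ 0 for a
non-torsion P): open outside CM (Bertrand 1982); at an ANOMALOUS p the unit-root height has the
extra a_p ≡ 1 pole and no transcendence method is known; one rank-1 anomalous curve with ĥ_p(P) = 0
refutes it.) [Schneider1982PadicHeightI, Schneider1985, MazurTate1983Biext,
MazurTateTeitelbaum1986Invent, MazurSteinTate2006, SteinWuthrich2013, Bertrand1982, PerrinRiou1987]
#9 PublishedInputs (support) — The PUBLISHED named facts the class assemblies display, as one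
conjunction of the tree's cited `Prop`s: CGLS 2022 Thm 5.1.1 (torsion-free anticyclotomic control),
Cassels' isogeny invariance of the BSD quotient, Greenberg–Vatsal 2000 Thm 1.3 and the
multiplicative (λ, μ) theorem, Greenberg 1999 Thm 4.1 (rank-0 Euler characteristic), modularity
(parametrisation, newform), Hoffstein–Luo / BFH non-vanishing twists, Gross–Zagier I.7.3,
Gross–Zagier and Kolyvagin over K, rank = analytic rank ≤ 1 with Ш finite, Schneider 1985 (order of
the characteristic power series, odd p), Perrin-Riou's rank-one leading terms (odd p), Wuthrich 2014
Thm 16, Stein–Wuthrich 2013 Thm 6.1 (split / non-split) and canonical multiplicative heights,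
Greenberg–Stevens 1993. Each conjunct is a Literature fact with a cite tag; provable-now means:
discharge conjunct by conjunct as the `_holds` theorems land, else carried as displayed PUB
hypotheses. [difficulty: provable-now] [CastellaGrossiLeeSkinner2022, GreenbergVatsal2000,
GreenbergLNM1716, Wuthrich2014, SteinWuthrich2013, GreenbergStevens1993, Schneider1985,
PerrinRiou1987, GrossZagier1986, KolyvaginEulerSystems1990, HoffsteinLuo1997, BCDT2001]
#9 AnalyticMuZeroOffLocus (support, conjecture; item stmt-BirchSwinnertonDyer-27407, rev 19) —
Vatsal 2005 Conj. 1.14(2) at r = 0 OFF the ramified-odd-line locus on X2b: the analytic μ-invariant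
of the (Ω⁺-normalised, Mazur–Tate–Teitelbaum) cyclotomic p-adic L-function is 0 (typed as ∃ k,
p^{-1} < ‖coeff_k‖; definitionally the expired mudescent v3 `stub_analyticMuZero_offLocus`, unfolded
since the route file lacks the `EisensteinMuConjecture` / `X2.AnalyticInvariants` imports); with the
kernel bridge p611383/p611858 it is the analytic μ-input of the μ-descent line on #3;
EisensteinMuBarrier is the ON-locus statement and is not touched. Status: open (Vatsal Thm 1.16 =
the r ≥ 1 ⇒ μ ≥ 1 direction only); census 4 371 / 9 142 X2 pairs μ_an = 0 off locus, 0 against.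
[difficulty: open-problem] [Vatsal2005, GreenbergVatsal2000, BellaichePollack2019]
#9 HeegnerIndexIdentityKRankOne (support, conjecture/PRE, rev 19) — the Heegner-index identity over
K at p ∥ N with r_an(E/K) = 1 in BOTH rank orientations (r_an(E) + r_an(E^{(d_K)}) = 1): E/ℚ
globally minimal of conductor N, p ≠ 2 multiplicative, E[p] reducible, K imaginary quadratic with
d_K odd < −4 and the Heegner hypothesis, a parametrisation datum with p ∤ c, P ∈ E(K) the Heegner
point, Ш(E/K) finite ⟹ `X11b.IndexIdentityAt W p K P` (2 ord_p ∏c(E) + ord_p #Ш(E/K) = 2 ord_p [E(K)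
: ℤP]). The r_an(E) = 1 orientation IS crux 4's typed input `X2.HeegnerIndexIdentity` (road B11),
the r_an(E) = 0 orientation is the twist-back road's `hHI0` (road A10); both projections are
fact-free and the converse holds given entire L-functions (pen `Sketch5.lean`, rc 0). Status: NOT in
print at p ∥ N for reducible E[p] — Keller–Yin 2024 Thm D (5.1.3) + §7 control (PREPRINT) with a BDP
formula at p ∥ N (Castella 2018 (5.3): p ≥ 5; the p = 3 bulk of O9 uncovered); CGLS 2022 (5.6) is
the good-ordinary analogue; Jetchev–Skinner–Wan need irreducible E[p]. [difficulty: open-problem]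
[KellerYin2024, Castella2018, CastellaEtAl2021, CastellaGrossiLeeSkinner2022, JetchevSkinnerWan2017,
GrossZagier1986, BertoliniDarmonPrasanna2013]
#9 SchneiderOnX2CellCGV (support, conjecture, rev 19) — the X2 twin of crux 6: Schneider's
conjecture (non-vanishing of the canonical cyclotomic p-adic regulator) at every X2c ∩ GVPar pair
for the CANONICAL multiplicative heights of Stein–Wuthrich 2013 §4.2 — non-split sign over every
Tate parameter q with j(q) = j(E) (`IsMultCanonical`), split sign over every Tate-parameter datum
(`IsSplitMultCanonical`) = hSchN ∧ hSchS of p623232 binder for binder. With Disegni 2020 Thm 4, PUB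
and the split exceptional leading term it gives BSDp on X2c ∩ GVPar through the O9 closers (pen
`Sketch5.lean` `bsdp_cellC_gvPar_of_items`). Status: open outside CM (Bertrand 1982); per pair
certifiable (REG-MULT instrument); barrier PAdicHeightBarrier INSIDE (declared, as for crux 6).
[difficulty: open-problem] [Schneider1985, SteinWuthrich2013, Disegni2020, Bertrand1982]

TWO-LAYER PLAN. MazurMCOnCellB ⇐ (MazurMCOnCellBSplit: the split sub-row, per pair by route G /
route T at layer 1, class-wide by the K5 isogeny-descent of μ) → (MazurMCOnCellBNonsplit: the
non-split sub-row by CGS §§1–3, 6 at the p-new point = R9-WORK, rider B8 at p = 3) → MazurMCOnCellB,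
glue = `X2.CellB` case split on the reduction sign. BSDpOnCellC ⇐ (BSDpOnCellCNonsplit: cgshw's (b1)
road `NonsplitHalvesOnTree` from c1 ∧ c2 ∧ c3, files p404147/p404431/p404695) → (BSDpOnCellCSplit:
the display `X2.RankOneDisplay` on the split half + MazurMCOnCellB at the partner via
`targetC_of_rankOneDisplay_of_targetB`, or the split analogue of (b1)) → BSDpOnCellC, glue =
`ClassClosureO9` sub-cell closers / case split on the reduction sign. MazurMCOnX1RankZero ⇐
(X1RankZeroDisplay per pair via a closed GV relative, head
`algebraicInvariantsEq_of_closedRelative_goodOrd_of_facts`) → (EisensteinMuDescentX1: μ of the μ > 0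
member from the μ = 0 member by Λ-adic isogeny invariance, Schneider 1987 / Perrin-Riou 1989) →
MazurMCOnX1RankZero. ROUTE-STRUCTURE NOTE (rev 19; pen bsd-eis-pen-1 g0 for director-bsd g13
(170′)(e′) and eis RECORD #26; audit of record referee g85, REF-VERDICT-WAVE-g85 sha16
9e461f9d67f105c2: p622525 §4/§5 CLEAN, p623232 §3 CLEAN, p623836 hHI0/hHI1 CONFIRMED). DECISION: the
twist-back structure is carried by two SUPPORT items consumed BY NAME by lines —
HeegnerIndexIdentityKRankOne and SchneiderOnX2CellCGV — and by NO new crux; `closes` is unchanged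
(one crux per ladder row stands; #3 and #4 both stay load-bearing because the identity between them
is itself unproved). Kernel compositions (pen `Sketch5.lean` rc 0 / 0 sorry, over p623836 §2/§3 +
the O9 closers): MazurMCOnCellB ⇐ PublishedInputs ∧ hHP ∧ Edixhoven ∧ Mazur 1978 Cor 4.1 ∧ BFH ∧
Disegni 2020 Thm 4 (FACT) → HeegnerIndexIdentityKRankOne (PRE) → SchneiderOnX2CellCGV (open,
per-pair CERT) → [∀ split X2c ∩ GVPar pairs: `X2.O9.ExceptionalLeadingTermAt`] (open for reducible
E[p], per-pair CERT) → MazurMCOnCellB (`mazurMCOnCellB_of_items`); BSDpOnCellC ⇐ the same FACTS →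
HeegnerIndexIdentityKRankOne → MazurMCOnCellB → BSDpOnCellC (`bsdpOnCellC_of_items`). A «twistback»
skeleton on #3 (if a LEAD registers it) states its stubs BY NAME: {FACTS; `stub_indexIdentity :
HeegnerIndexIdentityKRankOne`; `stub_schneider : SchneiderOnX2CellCGV`; `stub_excLT` (split X2c ∩
GVPar)} composed by `mazurMCOnCellB_of_indexIdentityRankZero_of_bsdp_cellC_gvPar`; mudescent v4
(460ece00…) stays the only skeleton of record on #3 until then. Nothing of the layer-2 splits above
is filed now.

KILL CRITERIA. A refutation of SchneiderOnX1TypeB (one anomalous rank-1 curve with vanishing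
canonical p-adic height) or of MazurMCOnCellB / MazurMCOnX1RankZero at one pair (a certified (μ, λ)
mismatch between the algebraic and analytic sides) closes the route `refuted:<Decl>` — and refutes
BSD(E,p) for that pair only if the published inputs stand, so the first response is an audit of the
pair's certificates. A published erratum withdrawing Keller–Yin Thm 3.0.8 forces a pivot of row A1
to the KY-free road (GV relative + μ-descent, TARGET §1.1 K-T5′). If BSDpOnClassX1 and X2.Target are
proved by other routes (e.g. a reducible-case Skinner–Urban theorem in print), the route is mooted
`superseded`. The three conjecture-class SUPPORT items (AnalyticMuZeroOffLocus,
HeegnerIndexIdentityKRankOne, SchneiderOnX2CellCGV) are not consumed by `closes`: a refutation of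
one of them (a certified μ_an > 0 off locus at r = 0; an X2 Heegner datum with 2 ord_p ∏c + ord_p
#Ш(E/K) ≠ 2 ord_p I; an X2c ∩ GVPar rank-1 pair with vanishing canonical multiplicative regulator)
BREAKS the route formally (gate) and kills the corresponding LINE (μ-descent / display road /
twist-back), not the thesis — repair = `--drop <Decl>` and the census of what the witness shows.

NOT DECOMPOSED YET. The per-pair lines (59 route-G displays, the 14 F9 layer-1 roads, cgshw's (b1)
Hsieh road, the X1 rank-0 displays) are deliberately NOT items: they are LINES under MazurMCOnCellB
/ BSDpOnCellC / MazurMCOnX1RankZero, registered as skeletons once the route is open (D-0019: two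
layers at most). The split/non-split and p = 3 / p ≥ 5 regime splits of MazurMCOnCellB and
BSDpOnCellC are layer-2 children for tenure. PublishedInputs is one support item rather than twenty
so that the cone of `closes` stays at six binders; its conjuncts are discharged one by one as
`_holds` theorems land.

CHEAPEST FALSIFIER. For SchneiderOnX1TypeB: compute the canonical 3-adic (and 5-adic) height of the
generator on the smallest X1 type-B rank-1 curves of the census (sigma formula, Mazur–Stein–Tate;
PARI `ellpadicheight`) — a zero to working precision kills the crux at once; the bsd-eis census (kit
j236359/j236410, ky MEMO-2) found none at the pairs it sampled. For MazurMCOnCellB per pair: the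
two-engine (μ, λ)_an tables versus the algebraic λ forced by the congruent relative (route G
checklist; 22/22 instruments matched on the 11 refereed displays, referee g12). For
GoodLatticeBDPValue: the referee's KY v2 §3 read-through (done twice, PASS modulo PRE). For
SchneiderOnX2CellCGV: the canonical multiplicative 3-adic regulator (Stein–Wuthrich §4.2
normalisation; REG-MULT instrument) of the generator on the smallest X2c ∩ GVPar rank-1 pairs — a
certified zero kills the item. For HeegnerIndexIdentityKRankOne: the minted B11 descent-certificate
rows (ord_3 Heegner index vs #Ш(E/K)·∏c²). For AnalyticMuZeroOffLocus: the two-engine μ_an tables (4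
371 / 9 142 pairs, all 0).

NUMBERS. Cells at p = 3 … 13 in the N9/O9 atlases (TARGET.md §7): A1 = 7 892 cells ‖ 8 604 pairs (X1
type A, r = 1); A2 = 1 307 (X1 type B, r = 1); A3 = X1 r = 0; A10 = 83 split + 44 non-split cells at
p = 3 (route G: 59 full displays accepted, 14 refereed; typed roads 53/83 · 31/44 of record, 67/83
with F9); B11 = O9 12 665 cells (12 106 at p = 3). GV (μ, λ) instrument tables: two engines
identical 109/109 on the F9 set, 22/22 on the refereed displays.

DEFINITION REQUESTS. None: every notion is in the tree (`ClassX1`, `GVPar`, `X2.CellB`,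
`X2.MazurMainConjectureAt`, `X2.RankOneDisplay`, `PAdicHeightData.IsCanonical`,
`SchneiderConjecture`, `MazurMainConjecture`, the K5 leaf
`Rank1Residual.Eisenstein.EisensteinPrimes` p404820). Rev 19 items use only tree notions too:
`X11b.IndexIdentityAt` (BDPRoute), `X2.CellCNonsplitGV` / `X2.CellCSplitGV` /
`X2.O9.ExceptionalLeadingTermAt` (ClassClosureO9), `SteinWuthrich2013.IsMultCanonical` /
`IsSplitMultCanonical`, `HeegnerDatum`, `heegnerPointComplex`, `ModularParametrizationData`; the
route imports gain the two defining modules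
`Summits.BirchSwinnertonDyer.Rank1Residual.X11b.BDPRoute` and `…X2.ClassClosureO9` (neither sees the
route file: no cycle).

Novelty: Searches (2026-08-25): `ledger route ls` (BirchSwinnertonDyer: 10 Theses — DefiniteTheta,
FrozenTwin, HigherGrossZagier, KatoTransfer, LeadingTerm, MockTateDerivative, NormCapitulation,
OnePairExactOrder, PAdicOrder, PAdicOrderV2 — none on reducible E[p]); `ledger negatives --problem
BirchSwinnertonDyer` (no reducible-pair statement); lit dossier of the cell `HOME/LIT-DOSSIER.md`
§§1–23 (KellerYin2024 v2, CGLS 2022, CGS 2023, BSTW 2024, KLZ17, Hida 85/88, Greenberg–Vatsal 2000,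
Wuthrich 2014, Stein–Wuthrich 2013); `lit search "Eisenstein prime main conjecture reducible"` /
`"anomalous prime p-adic height Schneider"` (hits: GreenbergVatsal2000, KellerYin2024,
CastellaGrossiSkinner2025, BellaichePollack2019; Schneider1985, MazurSteinTate2006).
Nearest prior art found: KellerYin2024 (Theorem A: BSD(E,p) for X1 type A rank 1 modulo Thm 3.0.8 —
exactly crux GoodLatticeBDPValue's consumer) and CastellaGrossiSkinner2025 (good Eisenstein primes,
rank ≤ 1, non-anomalous) — the route is the union of their residues with Greenberg–Vatsal's, typed.
Delta: not a new mechanism — a LEDGER FORM of the cell's programme: the five open inputs of the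
reducible rank ≤ 1 residue (one per ladder row) typed as cruxes over the tree's class assemblies,
with a certified six-binder `closes` onto the rung-K5 leaf; new relative to the ledger (first route
on reducible pairs), known relative to the literature.
Claimed grade: new-combination  [refs: KellerYin2024, GreenbergVatsal2000, CastellaGrossiSkinner2025, BellaichePollack2019, Schneider1985, MazurSteinTate2006]

Barriers (technique_class: iwasawa-main-conjecture, congruence-transfer, padic-heights): - technique_class: iwasawa-main-conjecture, congruence-transfer, padic-heights
- Literature.Barriers.BirchSwinnertonDyer.PAdicHeightBarrier: it does not evade it — crux
SchneiderOnX1TypeB IS the rank-one height non-degeneracy the barrier names (row A2 is declared, not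
hidden); the other four cruxes and the X1 type-A / X2 assemblies are height-free (Kato-type
inequalities + main-conjecture equalities + BDP values use the p-adic logarithm of a Heegner point,
non-zero in rank 1 without any height).
- Literature.Barriers.BirchSwinnertonDyer.ExceptionalZeroBarrier: discharged, not evaded — the split
multiplicative clause of `X2.MazurMainConjectureAt` carries the trivial-zero factor and
`greenberg_stevens` (GS 1993, PUB) is a displayed published input; no crux asserts a naive order of
vanishing at a split p.
- Literature.Barriers.BirchSwinnertonDyer.AnticyclotomicHeightDegeneracy: evaded — the lines of
BSDpOnCellC (display road, (b1) road) and GoodLatticeBDPValue go through BDP values at the trivial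
character and Kolyvagin, never through an anticyclotomic height pairing (which vanishes on E(ℚ) ×
E(ℚ)).
- Literature.Barriers.BirchSwinnertonDyer.HeegnerPointBarrier: inside its regime by design (analytic
rank ≤ 1 only; the leaf quantifies over analyticRank ≤ 1).
- Literature.Barriers.BirchSwinnertonDyer.ExceptionalZeroBarrierNarrow: discharged the same way — no
item uses the Mazur–Tate–Teitelbaum `L_p(E,T)` at a split multiplicative p without the 𝓛-invariant
correction: the split cell

History (route lifecycle, newest last):
- 2026-08-26T05:55:59Z · rev 8: informal re-worded for MazurMCOnX1RankZero (planner-bsd-eis-plan-g15-0)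
- 2026-08-27T06:41:18Z · rev 13: dropped stmt-BirchSwinnertonDyer-20113 — duplicate of stmt-BirchSwinnertonDyer-20112 (planner g20 double add of the same aside AnalyticCongruenceTransferTypeA; keep -20112) (planner-bsd-eis-plan-g20-0)
- 2026-08-27T08:10:28Z · rev 16: informal re-worded for AnalyticCongruenceTransferTypeA (planner-bsd-eis-plan-g21-0)

sub-problem: BirchSwinnertonDyer · status: open · opened planner-bsd-eis-plan-g13-0 2026-08-25T21:08:35Z · rev 19 · ledger route-BirchSwinnertonDyer-EisensteinPrimes
GENERATED by the gate from the ledger (D-0016/17). Provers cite these decls: `theorem foo : Summit.BirchSwinnertonDyer.BirchSwinnertonDyer.Theses.EisensteinPrimes.<Decl> := …` in Summits/BirchSwinnertonDyer/BirchSwinnertonDyer/Theorems/<Name>.lean.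
-/

namespace Summit.BirchSwinnertonDyer.BirchSwinnertonDyer.Theses.EisensteinPrimes

open scoped BigOperators Topology Manifold Classical MeasureTheory ProbabilityTheory Matrix InnerProductSpace ComplexConjugate ContinuousMap
open Filter Set Function TopologicalSpace MeasureTheory

attribute [summit_statement] _root_.BirchSwinnertonDyer
attribute [summit_statement] _root_.Summit.BirchSwinnertonDyer.Rank1Residual.Eisenstein.EisensteinPrimes

open Literature

/-- item stmt-BirchSwinnertonDyer-19032 · crux · rank 2 · open · by planner
why it might fail: Preprint theorem: the good-lattice IMC2 needs torsion-free anticyclotomic control at an anomalous p (CGLS 2022 Thm 5.1.1 shape) and a μ = 0 input for the BDP L-function at Eisenstein p; a gap in KY v2 §3 at p = 3 or for p | a_p − 1 twice would void it.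
sources: KellerYin2024, CastellaGrossiLeeSkinner2022, BertoliniDarmonPrasanna2013, CastellaGrossiSkinner2025
[crux] Keller–Yin 2024 Theorem 3.0.8 in the form the tree names
`thm308_imc2_bdpValue_goodLattice_OPEN`: for E/ℚ with a rational p-isogeny at a good anomalous
(Eisenstein) prime p and an admissible imaginary quadratic K, the anticyclotomic main conjecture
IMC2 holds integrally for the GOOD lattice and the BDP p-adic L-function takes the predicted value
at the trivial character (the input h308 of Keller–Yin Theorem A on class X1 type A, rank 1; ladder
row A1, 7 892 cells ‖ 8 604 pairs). PREPRINT (arXiv v2); everything else Theorem A needs is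
published and typed. [difficulty: L] -/
@[route_item "route-BirchSwinnertonDyer-EisensteinPrimes", crux]
def GoodLatticeBDPValue : Prop :=
  Literature.NumberTheory.EllipticCurves.KellerYin2024.thm308_imc2_bdpValue_goodLattice_OPEN

/-- item stmt-BirchSwinnertonDyer-19033 · crux · rank 3 · open · by planner
why it might fail: Class-wide it contains Greenberg's μ-conjecture (Conj 1.11) at the étale end + the type-A λ-count (GV 2000 «very little»), printed only in families (Bellaïche–Pollack); per pair it needs a CLOSED 3-congruent relative — 16 A10 cells have none; non-split cyclotomic input at 3 unprinted (KLZ17 §7.2).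
sources: GreenbergVatsal2000, Wuthrich2014, Kato2004Asterisque, SkinnerUrban2014, GreenbergLNM1716, BellaichePollack2019
[crux] Mazur's cyclotomic main conjecture (characteristic ideal of the p-Selmer group over ℚ_∞ =
p-adic L-function, with the split-multiplicative trivial-zero clause) at EVERY X2b pair: E[p]
reducible, p of multiplicative reduction, analytic rank 0, Greenberg–Vatsal parity failing (so μ > 0
is allowed on the displayed member). Ladder row A10 (83 split + 44 non-split cells at p = 3 in the
N9 atlas; all p in the statement). Per pair it is reached by congruence transfer from a λ-minimal
relative (route G, 59 displays in the kernel modulo certificates) or by the non-split cyclotomic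
argument CGS §§1–3, 6 at the p-new point (R9-WORK); class-wide it is Greenberg's μ-conjecture in the
Eisenstein case plus one divisibility. [difficulty: open-problem] -/
@[route_item "route-BirchSwinnertonDyer-EisensteinPrimes", crux]
def MazurMCOnCellB : Prop :=
  ∀ (W : WeierstrassCurve ℚ) [W.IsElliptic] [W.IsGloballyMinimal] (p : ℕ) [Fact p.Prime], Summit.BirchSwinnertonDyer.Rank1Residual.X2.CellB W p → Summit.BirchSwinnertonDyer.Rank1Residual.X2.MazurMainConjectureAt W p

/-- item stmt-BirchSwinnertonDyer-19034 · crux · rank 4 · open · by planner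
why it might fail: c3 (IMC equality at the p-new point) is unprinted for reducible E[p] at p ‖ N (road H input KY24 Thm D′ is a PREPRINT; Hsieh Thm B / Cas18 Thm 3.1 need ρ̄ irreducible); c2 at p = 3 has no printed value theorem (Cas18 §2 is p ≥ 5; LZZ18 Thm 3.10 a LEAD); split control vs Manin switch is per pair.
sources: Hsieh2014, CastellaHsieh2018, Castella2018, CastellaGrossiSkinner2025, KingsLoefflerZerbes2017, KellerYin2024
[crux] BSD(E,p) in Miller's form (`BSDp W p`) for every X2c pair — E[p] reducible, p multiplicative,
analytic rank 1 — i.e. the tree's `X2.TargetC` (`∀ W p, X2.CellC W p → BSDp W p`, Cells.lean:133):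
ladder row B11 in PARTITION currency (O9: 12 665 cells, 12 106 at p = 3). Eligible closing lines:
the rank-one display road (`X2.targetC_of_rankOneDisplay_of_targetB`: stubs = `X2.RankOneDisplay` —
a Hsieh-frame BDP p-adic L-function with its value at the trivial character and the anticyclotomic
IMC equality on the tree side — + crux 3 at the partner) and the direct BSDp roads (cgshw's (b1)
non-split Hsieh road `X2/NonsplitHalvesOnTree` p404431/p404695 with declared residuals c1
`HsiehFrameResidualAt`, c2 `NonsplitBDPValueOnTree`, c3 `NonsplitIMCEqOnTree`; its split analogue
with the partner input). [deps: MazurMCOnCellB] [difficulty: open-problem] -/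
@[route_item "route-BirchSwinnertonDyer-EisensteinPrimes", crux]
def BSDpOnCellC : Prop :=
  Summit.BirchSwinnertonDyer.Rank1Residual.X2.TargetC

/-- item stmt-BirchSwinnertonDyer-19035 · crux · rank 5 · open · by planner
why it might fail: SHAPE (i) OR-node: derived from crux 2 + crux 6 + PUB(13) (p431172) — fails where KY v2 Thm 3.0.8 (preprint) gaps at anomalous p or a rank-1 type-B twist has degenerate p-adic height; standalone roads (μ-descent, double-twist orbit, relative transfer) contain Greenberg's μ-conjecture + the λ-count.
sources: KellerYin2024, GreenbergVatsal2000, Kato2004Asterisque, Wuthrich2014, SkinnerUrban2014, GreenbergLNM1716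
[crux] Mazur's cyclotomic main conjecture at every X1 pair (p good ordinary anomalous, E[p]
reducible) of analytic rank 0 (ladder row A3; on the Greenberg–Vatsal side it is GV Thm 1.3, so the
content is the type-A = ¬gvpar rows, where the μ-invariant of the displayed member is positive and
GV's argument does not apply). PRINT RECORD (T2, honest label): CLAIMED IN PREPRINT by Keller–Yin,
arXiv:2402.12781v2 Thm 3.0.10 (char X(E/ℚ_∞) = (L_p(E)) for 2 < p good, E[p] reducible — tree
statement `KellerYin2024.thm3010_charIdeal_eq_padicLFunction_OPEN`, binder-for-binder this crux's
conclusion; k5-c5's `mazurMCOnX1RankZero_of_thm3010`), resting on their anticyclotomic Thm 3.0.8 (=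
crux 2's input) — no refereed proof; inside the route, road H5 (k5-c5 p417726/p418413): crux 5 ⇐
crux 6 + `X1.RankZeroPartner.RankZeroDisplay` + PUB. [difficulty: open-problem; claimed-PRE] -/
@[route_item "route-BirchSwinnertonDyer-EisensteinPrimes", crux]
def MazurMCOnX1RankZero : Prop :=
  ∀ (W : WeierstrassCurve ℚ) [W.IsElliptic] [W.IsGloballyMinimal] (p : ℕ) [Fact p.Prime], Literature.NumberTheory.EllipticCurves.Rank1Residual.ClassX1 W p → W.analyticRank = 0 → Summit.BirchSwinnertonDyer.BirchSwinnertonDyer.Theorems.Rank1ResidualX1Defs.MazurMainConjecture W p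

/-- item stmt-BirchSwinnertonDyer-19036 · crux · rank 6 · open · by planner
why it might fail: It is p-adic height non-degeneracy in rank 1 (ĥ_p(P) ≠ 0 for a non-torsion P): open outside CM (Bertrand 1982); at an ANOMALOUS p the unit-root height has the extra a_p ≡ 1 pole and no transcendence method is known; one rank-1 anomalous curve with ĥ_p(P) = 0 refutes it.
sources: Schneider1982PadicHeightI, Schneider1985, MazurTate1983Biext, MazurTateTeitelbaum1986Invent, MazurSteinTate2006, SteinWuthrich2013
[crux] Schneider's conjecture on X1 type B in analytic rank 1: for every such pair (E, p) and every
p-adic height datum that IS the canonical (Mazur–Tate / Schneider) cyclotomic height — sigma formula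
on admissible points — the p-adic regulator is non-zero (ladder row A2, 1 307 cells; the rider I1 of
the Schneider cell). Consumed by `X1.bsdp_of_typeBRankOne_of_schneider` together with GV Thm 1.3,
Schneider 1985 and Perrin-Riou's rank-one leading terms (published) and the σ-existence theorem
proved in the tree. [difficulty: open-problem] -/
@[route_item "route-BirchSwinnertonDyer-EisensteinPrimes", crux]
def SchneiderOnX1TypeB : Prop :=
  ∀ (W : WeierstrassCurve ℚ) [W.IsElliptic] [W.IsGloballyMinimal] (p : ℕ) [Fact p.Prime], Summit.BirchSwinnertonDyer.Rank1Residual.X1.TypeBRankOne W p → ∀ Dh : WeierstrassCurve.PAdicHeightData W p, Dh.IsCanonical → WeierstrassCurve.SchneiderConjecture Dh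

/-- item stmt-BirchSwinnertonDyer-19037 · support · rank 9 · SPLIT (gen 1) into CGLSAnticyclotomicControlTorsionFree, BSDQuotientIsogenyInvariance, GVCharIdealEqOfGVPar, GreenbergCharValueRankZero, ModularParametrizationSupply, NewformOfEllipticCurve, HoffsteinLuoNonvanishingTwist, GrossZagierRationalPointI73, RankEqAnalyticRankLeOne, GVLambdaMuMultiplicative, WuthrichMultiplicativeDivisibilityReducible, PublishedInputsTail + glue PublishedInputsOfParts · direct attempts still welcome (low priority) · by planner
sources: CastellaGrossiLeeSkinner2022, GreenbergVatsal2000, GreenbergLNM1716, Wuthrich2014, SteinWuthrich2013, GreenbergStevens1993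
[support] The PUBLISHED named facts the class assemblies display, as one conjunction of the tree's
cited `Prop`s: CGLS 2022 Thm 5.1.1 (torsion-free anticyclotomic control), Cassels' isogeny
invariance of the BSD quotient, Greenberg–Vatsal 2000 Thm 1.3 and the multiplicative (λ, μ) theorem,
Greenberg 1999 Thm 4.1 (rank-0 Euler characteristic), modularity (parametrisation, newform),
Hoffstein–Luo / BFH non-vanishing twists, Gross–Zagier I.7.3, Gross–Zagier and Kolyvagin over K,
rank = analytic rank ≤ 1 with Ш finite, Schneider 1985 (order of the characteristic power series,
odd p), Perrin-Riou's rank-one leading terms (odd p), Wuthrich 2014 Thm 16, Stein–Wuthrich 2013 Thm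
6.1 (split / non-split) and canonical multiplicative heights, Greenberg–Stevens 1993. Each conjunct
is a Literature fact with a cite tag; provable-now means: discharge conjunct by conjunct as the
`_holds` theorems land, else carried as displayed PUB hypotheses. [difficulty: provable-now] -/
@[route_item "route-BirchSwinnertonDyer-EisensteinPrimes", crux]
def PublishedInputs : Prop :=
  Literature.NumberTheory.EllipticCurves.CastellaGrossiLeeSkinner2022.thm511_anticyclotomicControl_of_torsionFree ∧ WeierstrassCurve.bsdRHS_eq_of_isIsogenous ∧ Literature.NumberTheory.EllipticCurves.GreenbergVatsal2000.thm13_charIdeal_eq_of_gvPar ∧ Literature.NumberTheory.EllipticCurves.greenberg_charValue_rankZero ∧ Literature.NumberTheory.EllipticCurves.ModularForms.nonempty_modularParametrizationData ∧ Literature.NumberTheory.EllipticCurves.ModularForms.exists_isNewformOf ∧ Literature.NumberTheory.EllipticCurves.HoffsteinLuo1997_exists_twist_L_one_ne_zero ∧ Literature.NumberTheory.EllipticCurves.GrossZagier1986_thm_I_7_3 ∧ (∀ (N : ℕ) [NeZero N] (W : WeierstrassCurve ℚ) (K : Type) [Field K] [NumberField K], Literature.NumberTheory.EllipticCurves.gross_zagier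 N W K) ∧ (∀ (N : ℕ) [NeZero N] (W : WeierstrassCurve ℚ) (K : Type) [Field K] [NumberField K], Literature.NumberTheory.EllipticCurves.kolyvagin N W K) ∧ Literature.NumberTheory.EllipticCurves.rank_eq_analyticRank_of_analyticRank_le_one ∧ Literature.NumberTheory.EllipticCurves.Schneider1985_order_charGenerator_odd ∧ Literature.NumberTheory.EllipticCurves.perrinRiou_rankOne_leadingTerms_odd ∧ Literature.NumberTheory.EllipticCurves.GreenbergVatsal2000.lambdaMu_multiplicative_of_gvPar ∧ Literature.NumberTheory.EllipticCurves.Wuthrich2014.thm16_charIdeal_dvd_multiplicative_of_reducible ∧ Literature.NumberTheory.EllipticCurves.SteinWuthrich2013.thm61_splitMultiplicative ∧ Literature.NumberTheory.EllipticCurves.SteinWuthrich2013.thm61_nonsplitMultiplicative ∧ Literature.NumberTheory.EllipticCurves.SteinWuthrich2013.exists_isSplitMultCanonical ∧ Literature.NumberTheory.EllipticCurves.SteinWuthrich2013.exists_isMultCanonical ∧ (∀ (W : WeierstrassCurve ℚ) [W.IsElliptic] [W.IsGloballyMinimal] (p : ℕ) [Fact p.Prime], Literature.NumberTheory.EllipticCurves.greenberg_stevens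 (W := W) (p := p))

-- parent: PublishedInputs · child (gen 1)
/--     item stmt-BirchSwinnertonDyer-19485 · support · rank 901 · open
    parent: PublishedInputs · by operator
    sources: CastellaGrossiLeeSkinner2022
[support] Castella–Grossi–Lee–Skinner 2022 (Invent. Math. 227) Thm. 5.1.1: anticyclotomic control
for the torsion-free (BDP) Selmer group at an Eisenstein prime — conjunct 1 — conjunct of
PublishedInputs (stmt-BirchSwinnertonDyer-19037), BY NAME; same content, filed as a split child so
the head constant is item-stated (gate5 #15c one rule; readiness rule 2026-08-15: cite_only dep
declared by the route; director-bsd 05:15:22Z K5 staffable remedy); no crux statement / closes /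
tribunal change -/
@[route_item "route-BirchSwinnertonDyer-EisensteinPrimes"]
def CGLSAnticyclotomicControlTorsionFree : Prop :=
  Literature.NumberTheory.EllipticCurves.CastellaGrossiLeeSkinner2022.thm511_anticyclotomicControl_of_torsionFree

-- parent: PublishedInputs · child (gen 1)
/--     item stmt-BirchSwinnertonDyer-19307 · support · rank 902 · open
    parent: PublishedInputs · by operator
    sources: Cassels1965ArithmeticVIII, MilneADT2006
[support] Cassels 1965 (Arithmetic on curves of genus 1, VIII; J. reine angew. Math. 217) / Milne
ADT Thm I.7.3 and Rem I.7.4: the BSD quotient (right-hand side of the BSD formula) is invariant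
under isogeny over ℚ — conjunct of the support PrintedFacts (stmt-BirchSwinnertonDyer-19362), BY
NAME; same content, filed as a split child so the head constant is item-stated (gate5 #15c one rule;
readiness rule 2026-08-15: cite_only dep declared by the route; director-bsd 2026-08-26T04:22Z
«K3/E2 shape»); no crux statement / closes / tribunal change -/
@[route_item "route-BirchSwinnertonDyer-EisensteinPrimes"]
def BSDQuotientIsogenyInvariance : Prop :=
  WeierstrassCurve.bsdRHS_eq_of_isIsogenous

-- parent: PublishedInputs · child (gen 1)
/--     item stmt-BirchSwinnertonDyer-19486 · support · rank 903 · open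
    parent: PublishedInputs · by operator
    sources: GreenbergVatsal2000
[support] Greenberg–Vatsal 2000 (Invent. Math. 142) Thm. 1.3: at a GV pair (E[p] reducible, GV
parity condition) the cyclotomic main conjecture holds — conjunct 3 — conjunct of PublishedInputs
(stmt-BirchSwinnertonDyer-19037), BY NAME; same content, filed as a split child so the head constant
is item-stated (gate5 #15c one rule; readiness rule 2026-08-15: cite_only dep declared by the route;
director-bsd 05:15:22Z K5 staffable remedy); no crux statement / closes / tribunal change -/
@[route_item "route-BirchSwinnertonDyer-EisensteinPrimes"]
def GVCharIdealEqOfGVPar : Prop :=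
  Literature.NumberTheory.EllipticCurves.GreenbergVatsal2000.thm13_charIdeal_eq_of_gvPar

-- parent: PublishedInputs · child (gen 1)
/--     item stmt-BirchSwinnertonDyer-19460 · support · rank 904 · open
    parent: PublishedInputs · by planner
    sources: GreenbergLNM1716
[support, cite-only] Greenberg LNM 1716 Thm 4.1 (p. 102; held copy
book:coatesnd-arithmetic-theory-elliptic-curves chunk p0091): the rank-0 Euler-characteristic
formula f_E(0) ~ #Sel · ∏c_v · #Ẽ(𝔽_p)² / #E(ℚ)_tors² at good ordinary p — conjunct of
PublishedInputsX9 (stmt-BirchSwinnertonDyer-19632, text FROZEN REF v8-3), BY NAME; same content,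
filed as a split child so the head constant is item-stated (readiness rule 2026-08-15 / gate5 #15c:
a cite_only dep must be declared by the route); no crux statement / closes / tribunal change; never
staffed for proof (cite-only, to be HELD), closes only when the named fact becomes a theorem -/
@[route_item "route-BirchSwinnertonDyer-EisensteinPrimes"]
def GreenbergCharValueRankZero : Prop :=
  Literature.NumberTheory.EllipticCurves.greenberg_charValue_rankZero

-- parent: PublishedInputs · child (gen 1)
/--     item stmt-BirchSwinnertonDyer-19266 · support · rank 905 · open
    parent: PublishedInputs · by planner
    sources: BCDT2001, Wiles1995
[support] modularity of E/ℚ as parametrisation data (Breuil–Conrad–Diamond–Taylor 2001 Thm A), BY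
NAME — conjunct of OrdPublishedInputsAtTwo (19149; Literature.Uncategorized.OrdPublishedInputsAtTwo
l.26); same content, filed so the head constant is item-stated (#15c one rule; cite_only dep) -/
@[route_item "route-BirchSwinnertonDyer-EisensteinPrimes"]
def ModularParametrizationSupply : Prop :=
  Literature.NumberTheory.EllipticCurves.ModularForms.nonempty_modularParametrizationData

-- parent: PublishedInputs · child (gen 1)
/--     item stmt-BirchSwinnertonDyer-19382 · support · rank 906 · open
    parent: PublishedInputs · by planner
    sources: BCDT2001, Wiles1995
[support] Modularity Theorem, Version L (Diamond–Shurman 2005 Thm. 8.8.3; Wiles / Taylor–Wiles /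
BCDT 2001 Thm. A): every E/ℚ has a weight-2 newform f of level N_E with L(f,s) = L(E,s) — conjunct
of PublishedInputsFive (stmt-BirchSwinnertonDyer-19066), BY NAME; same content, filed as a split
child so the head constant is item-stated (gate5 #15c one rule / readiness rule 2026-08-15: a
cite_only dep must be declared by the route); no crux statement / closes / tribunal / tribunal_fit
change -/
@[route_item "route-BirchSwinnertonDyer-EisensteinPrimes"]
def NewformOfEllipticCurve : Prop :=
  Literature.NumberTheory.EllipticCurves.ModularForms.exists_isNewformOf

-- parent: PublishedInputs · child (gen 1)
/--     item stmt-BirchSwinnertonDyer-19372 · support · rank 907 · open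
    parent: PublishedInputs · by planner
    sources: HoffsteinLuo1997, BumpFriedbergHoffstein1990
[aside] Hoffstein–Luo 1997 Theorem (§1, pp. 435–436), as used in Matsuno 2009 proof of Prop. 6.1: a
quadratic twist with L(E^D,1) ≠ 0 under prescribed local conditions — conjunct of
PublishedInputsFive (stmt-BirchSwinnertonDyer-19066) kept inside the k = 7 rest child
ClassicalAndTwistInputsFive and item-stated here BY NAME as an ASIDE (banked context, never staffed,
BC6-exempt) so the cite_only dep is declared (#15c); no crux statement / closes / tribunal change -/
@[route_item "route-BirchSwinnertonDyer-EisensteinPrimes"]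
def HoffsteinLuoNonvanishingTwist : Prop :=
  Literature.NumberTheory.EllipticCurves.HoffsteinLuo1997_exists_twist_L_one_ne_zero

-- parent: PublishedInputs · child (gen 1)
/--     item stmt-BirchSwinnertonDyer-19369 · support · rank 908 · open
    parent: PublishedInputs · by planner
    sources: GrossZagier1986
[aside] Gross–Zagier 1986 Thm. I.(7.3) (p. 231; proof V.§2 pp. 310–313): L′(E,1) ≠ 0 ⇒ a rational
point of infinite order (via a Heegner point and the GZ formula) — a cite_only dep of this route
reached through the depth-1 support item PublishedInputsIMCReduction
(stmt-BirchSwinnertonDyer-19283, child of 19061; a third item layer is forbidden, so it is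
item-stated here as a by-name ASIDE: banked context, never staffed, BC6-exempt; gate5 02:15:40Z
«aside also counts»); no crux statement / closes / tribunal change -/
@[route_item "route-BirchSwinnertonDyer-EisensteinPrimes"]
def GrossZagierRationalPointI73 : Prop :=
  Literature.NumberTheory.EllipticCurves.GrossZagier1986_thm_I_7_3

-- parent: PublishedInputs · child (gen 1)
/--     item stmt-BirchSwinnertonDyer-19921 · support · rank 909 · open
    parent: PublishedInputs · by operator
    sources: GrossZagier1986, Kolyvagin1990
[support] The one PUBLISHED input the halves-glue consumes: Gross–Zagier–Kolyvagin, rank = analytic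
rank for analytic rank ≤ 1 with Ш finite (tree named fact
rank_eq_analyticRank_of_analyticRank_le_one; used by bsdp_of_missingPPartAt to turn Miller's last
clause into BSD(E,2)). Carried as a displayed PUB hypothesis; never counted as progress. The further
PRINT of the roads to the two halves (Greenberg Thm-4.1 analogues at a multiplicative prime
thm41Analogue_charValue_rankZero_numberField_anyPrime / …_split_baseChange_anyPrime, modularity) and
the referee-passed MEMO inputs (Kato ⊗ℚ at a multiplicative 2:
X5.O1.KatoMultiplicativeDivisibilityRat W 2, HOME mult/PROOF-MULT.md RC-2; Greenberg–Stevens at 2: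
greenberg_stevens W 2, mult/PROOF-GS2.md RC-4) enter the LINES under the halves (bridge
multiplicativeRankZeroAtTwo_of_muRoad, p409679), not this glue. -/
@[route_item "route-BirchSwinnertonDyer-EisensteinPrimes"]
def RankEqAnalyticRankLeOne : Prop :=
  Literature.NumberTheory.EllipticCurves.rank_eq_analyticRank_of_analyticRank_le_one

-- parent: PublishedInputs · child (gen 1)
/--     item stmt-BirchSwinnertonDyer-19487 · support · rank 910 · open
    parent: PublishedInputs · by operator
    sources: GreenbergVatsal2000
[support] Greenberg–Vatsal 2000, multiplicative reduction: (λ, μ) of the algebraic and analytic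
sides agree at a reducible multiplicative GV pair (`lambdaMu_multiplicative_of_gvPar`) — conjunct 14
— conjunct of PublishedInputs (stmt-BirchSwinnertonDyer-19037), BY NAME; same content, filed as a
split child so the head constant is item-stated (gate5 #15c one rule; readiness rule 2026-08-15:
cite_only dep declared by the route; director-bsd 05:15:22Z K5 staffable remedy); no crux statement
/ closes / tribunal change -/
@[route_item "route-BirchSwinnertonDyer-EisensteinPrimes"]
def GVLambdaMuMultiplicative : Prop :=
  Literature.NumberTheory.EllipticCurves.GreenbergVatsal2000.lambdaMu_multiplicative_of_gvPar

-- parent: PublishedInputs · child (gen 1)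
/--     item stmt-BirchSwinnertonDyer-19488 · support · rank 911 · open
    parent: PublishedInputs · by operator
    sources: Wuthrich2014
[support] Wuthrich 2014 (Trans. AMS 366) Thm. 16: Kato-side divisibility char X(E/ℚ_∞) ∣ (L_p(E)) at
multiplicative p with E[p] reducible (`thm16_charIdeal_dvd_multiplicative_of_reducible`) — conjunct
15 — conjunct of PublishedInputs (stmt-BirchSwinnertonDyer-19037), BY NAME; same content, filed as a
split child so the head constant is item-stated (gate5 #15c one rule; readiness rule 2026-08-15:
cite_only dep declared by the route; director-bsd 05:15:22Z K5 staffable remedy); no crux statement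
/ closes / tribunal change -/
@[route_item "route-BirchSwinnertonDyer-EisensteinPrimes"]
def WuthrichMultiplicativeDivisibilityReducible : Prop :=
  Literature.NumberTheory.EllipticCurves.Wuthrich2014.thm16_charIdeal_dvd_multiplicative_of_reducible

-- parent: PublishedInputs · child (gen 1)
/--     item stmt-BirchSwinnertonDyer-19489 · support · rank 912 · open
    parent: PublishedInputs · by operator
    sources: GrossZagier1986, Kolyvagin1990, Schneider1985, PerrinRiou1987, SteinWuthrich2013, GreenbergStevens1993
[support] conjuncts 9, 10, 12, 13, 16, 17, 18, 19, 20 of PublishedInputs VERBATIM as one tail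
conjunction (Gross–Zagier and Kolyvagin over K (∀-closures), Schneider 1985 (odd p), Perrin-Riou
rank-one leading terms (odd p), Stein–Wuthrich 2013 Thm. 6.1 split / non-split + canonical
multiplicative heights (existence), Greenberg–Stevens 1993 (∀-closure)) — the k = 12 split shape
(items cap 15 forbids 17 asides; split.k_max forbids 18 children): the six cite_only constants
inside it are item-stated BY NAME as `aside` items of this route (SchneiderOrderCharGeneratorOdd,
PerrinRiouRankOneLeadingTermsOdd, SteinWuthrichLeadingTermSplit, SteinWuthrichLeadingTermNonsplit,
SteinWuthrichSplitMultCanonicalExists, SteinWuthrichMultCanonicalExists); the three ∀-closures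
(gross_zagier, kolyvagin, greenberg_stevens) are not cite_only deps. conjunct of PublishedInputs
(stmt-BirchSwinnertonDyer-19037), BY NAME; same content, filed as a split child so the head constant
is item-stated (gate5 #15c one rule; readiness rule 2026-08-15: cite_only dep declared by the route;
director-bsd 05:15:22Z K5 staffable remedy); no crux statement / closes / tribunal change -/
@[route_item "route-BirchSwinnertonDyer-EisensteinPrimes"]
def PublishedInputsTail : Prop :=
  (∀ (N : ℕ) [NeZero N] (W : WeierstrassCurve ℚ) (K : Type) [Field K] [NumberField K], Literature.NumberTheory.EllipticCurves.gross_zagier N W K) ∧ (∀ (N : ℕ) [NeZero N] (W : WeierstrassCurve ℚ) (K : Type) [Field K] [NumberField K], Literature.NumberTheory.EllipticCurves.kolyvagin N W K) ∧ Literature.NumberTheory.EllipticCurves.Schneider1985_order_charGenerator_odd ∧ Literature.NumberTheory.EllipticCurves.perrinRiou_rankOne_leadingTerms_odd ∧ Literature.NumberTheory.EllipticCurves.SteinWuthrich2013.thm61_splitMultiplicative ∧ Literature.NumberTheory.EllipticCurves.SteinWuthrich2013.thm61_nonsplitMultiplicative ∧ Literature.NumberTheory.EllipticCurves.SteinWuthrich2013.exists_isSplitMultCanonical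 ∧ Literature.NumberTheory.EllipticCurves.SteinWuthrich2013.exists_isMultCanonical ∧ (∀ (W : WeierstrassCurve ℚ) [W.IsElliptic] [W.IsGloballyMinimal] (p : ℕ) [Fact p.Prime], Literature.NumberTheory.EllipticCurves.greenberg_stevens (W := W) (p := p))

-- parent: PublishedInputs · glue (gen 1)
/--     item stmt-BirchSwinnertonDyer-19490 · support · rank 913 · closed · proved by Summit.BirchSwinnertonDyer.BirchSwinnertonDyer.Theorems.publishedInputsOfParts_holds (prover)
    parent: PublishedInputs · GLUE: children ⟹ parent · by operator
children = eleven cite_only conjuncts of PublishedInputs BY NAME (conjuncts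
1,2,3,4,5,6,7,8,11,14,15; statement = the constant) + the tail child PublishedInputsTail (conjuncts
9,10,12,13,16,17,18,19,20 verbatim); glue PublishedInputsOfParts : C1 → … → C11 →
PublishedInputsTail → PublishedInputs is reassembly of the 20 conjuncts in the parent's order
(plan-g15/staffable-v1/AliasSketch.lean publishedInputsOfParts_holds, farm rc 0) — one line for the
first idle hand -/
@[route_item "route-BirchSwinnertonDyer-EisensteinPrimes"]
def PublishedInputsOfParts : Prop :=
  CGLSAnticyclotomicControlTorsionFree → BSDQuotientIsogenyInvariance → GVCharIdealEqOfGVPar → GreenbergCharValueRankZero → ModularParametrizationSupply → NewformOfEllipticCurve → HoffsteinLuoNonvanishingTwist → GrossZagierRationalPointI73 → RankEqAnalyticRankLeOne → GVLambdaMuMultiplicative → WuthrichMultiplicativeDivisibilityReducible → PublishedInputsTail → PublishedInputs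

-- `PublishedInputsOfParts` holds: proved by `Summit.BirchSwinnertonDyer.BirchSwinnertonDyer.Theorems.publishedInputsOfParts_holds` (its module imports this route file, so no `_holds` link can be stated here).

/-- item stmt-BirchSwinnertonDyer-19470 · aside · rank 9 · open · by planner
sources: Schneider1985
[aside] Schneider 1985 (Invent. Math. 79) Thm. 2′: for odd p (good ordinary or multiplicative),
ord_T of the characteristic power series vs rank and the leading-term formula with the p-adic height
(`Schneider1985_order_charGenerator_odd`) — conjunct 12. Banked context (D-0019 aside): never
staffed, not progress, BC6-exempt; filed ONLY so the cite_only head constant inside the tail child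
PublishedInputsTail of the PublishedInputs split is item-stated BY NAME (gate5 #15c one rule, kind
support OR aside counts; K3 README fallback shape; director-bsd 05:15:22Z K5 staffable remedy); no
crux statement / closes / tribunal / tribunal_fit change intended. -/
@[route_item "route-BirchSwinnertonDyer-EisensteinPrimes"]
def SchneiderOrderCharGeneratorOdd : Prop :=
  Literature.NumberTheory.EllipticCurves.Schneider1985_order_charGenerator_odd

/-- item stmt-BirchSwinnertonDyer-19471 · aside · rank 9 · open · by planner
sources: PerrinRiou1987
[aside] Perrin-Riou 1987 (p-adic Gross–Zagier, odd p): rank-one leading terms of the p-adic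
L-function / characteristic series vs the p-adic height of the Heegner point
(`perrinRiou_rankOne_leadingTerms_odd`) — conjunct 13. Banked context (D-0019 aside): never staffed,
not progress, BC6-exempt; filed ONLY so the cite_only head constant inside the tail child
PublishedInputsTail of the PublishedInputs split is item-stated BY NAME (gate5 #15c one rule, kind
support OR aside counts; K3 README fallback shape; director-bsd 05:15:22Z K5 staffable remedy); no
crux statement / closes / tribunal / tribunal_fit change intended. -/
@[route_item "route-BirchSwinnertonDyer-EisensteinPrimes"]
def PerrinRiouRankOneLeadingTermsOdd : Prop :=
  Literature.NumberTheory.EllipticCurves.perrinRiou_rankOne_leadingTerms_odd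

/-- item stmt-BirchSwinnertonDyer-19472 · aside · rank 9 · open · by planner
sources: SteinWuthrich2013
[aside] Stein–Wuthrich 2013 (Math. Comp. 82) Thm. 6.1, split multiplicative case: leading term of
the characteristic series with the extra zero (`thm61_splitMultiplicative`) — conjunct 16. Banked
context (D-0019 aside): never staffed, not progress, BC6-exempt; filed ONLY so the cite_only head
constant inside the tail child PublishedInputsTail of the PublishedInputs split is item-stated BY
NAME (gate5 #15c one rule, kind support OR aside counts; K3 README fallback shape; director-bsd
05:15:22Z K5 staffable remedy); no crux statement / closes / tribunal / tribunal_fit change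
intended. -/
@[route_item "route-BirchSwinnertonDyer-EisensteinPrimes"]
def SteinWuthrichLeadingTermSplit : Prop :=
  Literature.NumberTheory.EllipticCurves.SteinWuthrich2013.thm61_splitMultiplicative

/-- item stmt-BirchSwinnertonDyer-19473 · aside · rank 9 · open · by planner
sources: SteinWuthrich2013
[aside] Stein–Wuthrich 2013 Thm. 6.1, non-split multiplicative case (`thm61_nonsplitMultiplicative`)
— conjunct 17. Banked context (D-0019 aside): never staffed, not progress, BC6-exempt; filed ONLY so
the cite_only head constant inside the tail child PublishedInputsTail of the PublishedInputs split
is item-stated BY NAME (gate5 #15c one rule, kind support OR aside counts; K3 README fallback shape;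
director-bsd 05:15:22Z K5 staffable remedy); no crux statement / closes / tribunal / tribunal_fit
change intended. -/
@[route_item "route-BirchSwinnertonDyer-EisensteinPrimes"]
def SteinWuthrichLeadingTermNonsplit : Prop :=
  Literature.NumberTheory.EllipticCurves.SteinWuthrich2013.thm61_nonsplitMultiplicative

/-- item stmt-BirchSwinnertonDyer-19474 · aside · rank 9 · closed · proved by Summit.BirchSwinnertonDyer.BirchSwinnertonDyer.Theorems.steinWuthrichSplitMultCanonicalExists_holds (prover) · by planner
sources: SteinWuthrich2013
[aside] Stein–Wuthrich 2013 §4: existence of the canonical p-adic height datum, split multiplicative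
case (`exists_isSplitMultCanonical`) — conjunct 18. Banked context (D-0019 aside): never staffed,
not progress, BC6-exempt; filed ONLY so the cite_only head constant inside the tail child
PublishedInputsTail of the PublishedInputs split is item-stated BY NAME (gate5 #15c one rule, kind
support OR aside counts; K3 README fallback shape; director-bsd 05:15:22Z K5 staffable remedy); no
crux statement / closes / tribunal / tribunal_fit change intended. -/
@[route_item "route-BirchSwinnertonDyer-EisensteinPrimes"]
def SteinWuthrichSplitMultCanonicalExists : Prop :=
  Literature.NumberTheory.EllipticCurves.SteinWuthrich2013.exists_isSplitMultCanonical

-- `SteinWuthrichSplitMultCanonicalExists` holds: proved by `Summit.BirchSwinnertonDyer.BirchSwinnertonDyer.Theorems.steinWuthrichSplitMultCanonicalExists_holds` (its module imports this route file, so no `_holds` link can be stated here).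

/-- item stmt-BirchSwinnertonDyer-19475 · aside · rank 9 · closed · proved by Summit.BirchSwinnertonDyer.BirchSwinnertonDyer.Theorems.steinWuthrichMultCanonicalExists_holds (prover) · by planner
sources: SteinWuthrich2013
[aside] Stein–Wuthrich 2013 §4: existence of the canonical p-adic height datum, multiplicative case
(`exists_isMultCanonical`) — conjunct 19. Banked context (D-0019 aside): never staffed, not
progress, BC6-exempt; filed ONLY so the cite_only head constant inside the tail child
PublishedInputsTail of the PublishedInputs split is item-stated BY NAME (gate5 #15c one rule, kind
support OR aside counts; K3 README fallback shape; director-bsd 05:15:22Z K5 staffable remedy); no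
crux statement / closes / tribunal / tribunal_fit change intended. -/
@[route_item "route-BirchSwinnertonDyer-EisensteinPrimes"]
def SteinWuthrichMultCanonicalExists : Prop :=
  Literature.NumberTheory.EllipticCurves.SteinWuthrich2013.exists_isMultCanonical

-- `SteinWuthrichMultCanonicalExists` holds: proved by `Summit.BirchSwinnertonDyer.BirchSwinnertonDyer.Theorems.steinWuthrichMultCanonicalExists_holds` (its module imports this route file, so no `_holds` link can be stated here).

/-- item stmt-BirchSwinnertonDyer-20112 · aside · rank 9 · open · by planner
sources: GreenbergVatsal2000
[aside] (C-λ) ANALYTIC CONGRUENCE TRANSFER AT REDUCIBLE TYPE-A E[p] (conjecture mined from data by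
bsd-eis-lam-a g5; NOT in print — lit §81; Greenberg–Vatsal 2000 (10) is printed only for IRREDUCIBLE
E[p]): for p odd, W on cell B of X2 (or good ordinary, X1) of parity type A with no ramified odd
line, and W′ with W[p] ≃ W′[p] (`TorsionIso`) and μ_an(W′) = 0, the ι-oriented Σ₀-imprimitive p-adic
L-functions are proportional mod p: ∃ u ∈ (ℤ/p)ˣ, Ḡ·∏_{S₀}𝒫̄ι(W) = u·Ḡ′·∏_{S₀}𝒫̄ι(W′) in 𝔽_p⟦T⟧
(ready-to-type text: HOME/lam-a-g5/lam-a-MEMO-5.md §5 1b, sha16 71548bcd2d377127; phrase it with the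
existing `eulerFactorProduct` on the ι-conjugates, no new def). Evidence: kit j269773 (p = 3, N ≤
6000: 4 751/4 751 twin pairs proportional mod (3,T^81); p = 5, N < 10⁴: 130/130; non-twins 0/598),
j270612 (control: 1/1 512 proportional mod 9 ⇒ sharp at mod p). Consumers already in tree: p503647
§3/§4 (`X2.analyticMuLE_zero_and_analyticLambdaEq_of_truncCongr[_goodOrd]`), p505592. Banked context
(D-0019 aside; RULING L48): never staffed, not progress, not a binder of `closes`, BC6-exempt;
signature SET 2026-08-27T07:25Z by plan g20/g21 (3 376 chars, MEMO-5 §5 1b verbatim; elaborates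
against this rout -/
@[route_item "route-BirchSwinnertonDyer-EisensteinPrimes"]
def AnalyticCongruenceTransferTypeA : Prop :=
  ∀ (p : ℕ) [Fact p.Prime] (W W' : WeierstrassCurve ℚ) [W.IsElliptic] [W.IsGloballyMinimal] [W'.IsElliptic] [W'.IsGloballyMinimal], p ≠ 2 → Summit.BirchSwinnertonDyer.Rank1Residual.X2.CellB W p → (¬ ∃ Φ : AddSubgroup (W.geomTorsion (p : ℤ)), Literature.NumberTheory.EllipticCurves.Rank1Residual.IsRationalLine W p Φ ∧ ¬ Literature.NumberTheory.EllipticCurves.Rank1Residual.LineUnramifiedAt W p Φ ∧ Literature.NumberTheory.EllipticCurves.Rank1Residual.LineOdd W p Φ) → Summit.BirchSwinnertonDyer.Rank1Residual.X1.CongruenceTransfer.TorsionIso W W' p → ∀ {N : ℕ} [NeZero N] (f : CuspForm (CongruenceSubgroup.Gamma0 N) 2) (ϖ : ℚ) (L : PowerSeries ℚ_[p]) (G : Literature.NumberTheory.EllipticCurves.IwasawaAlgebra p), Literature.NumberTheory.EllipticCurves.ModularForms.IsNewformOf W f → (ϖ : ℝ) * W.realPeriodRat = Literature.NumberTheory.EllipticCurves.ModularForms.plusPeriod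 f → (W.HasSplitMultiplicativeReductionAtPrime p → Literature.NumberTheory.EllipticCurves.IsSplitMultPAdicLFunctionOf f p L) → (¬ W.HasSplitMultiplicativeReductionAtPrime p → Literature.NumberTheory.EllipticCurves.IsMultPAdicLFunctionOf f p (-1) L) → Literature.NumberTheory.EllipticCurves.iwasawaToPowerSeries p G = PowerSeries.C ((ϖ : ℚ) : ℚ_[p]) * L → ∀ {N' : ℕ} [NeZero N'] (f' : CuspForm (CongruenceSubgroup.Gamma0 N') 2) (ϖ' : ℚ) (L' : PowerSeries ℚ_[p]) (G' : Literature.NumberTheory.EllipticCurves.IwasawaAlgebra p), Literature.NumberTheory.EllipticCurves.ModularForms.IsNewformOf W' f' → (ϖ' : ℝ) * W'.realPeriodRat = Literature.NumberTheory.EllipticCurves.ModularForms.plusPeriod f' → ((W'.HasSplitMultiplicativeReductionAtPrime p ∧ Literature.NumberTheory.EllipticCurves.IsSplitMultPAdicLFunctionOf f' p L') ∨ (W'.HasMultiplicativeReductionAtPrime p ∧ ¬ W'.HasSplitMultiplicativeReductionAtPrime p ∧ Literature.NumberTheory.EllipticCurves.IsMultPAdicLFunctionOf f' p (-1) L') ∨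 (W'.HasGoodReductionAtPrime p ∧ Literature.NumberTheory.EllipticCurves.IsOrdinaryAt W' p ∧ L' = Literature.NumberTheory.EllipticCurves.padicLFunction f' (Literature.NumberTheory.EllipticCurves.unitRoot W' p : ℚ_[p]))) → Literature.NumberTheory.EllipticCurves.iwasawaToPowerSeries p G' = PowerSeries.C ((ϖ' : ℚ) : ℚ_[p]) * L' → (∃ k : ℕ, ((p : ℝ))⁻¹ < ‖PowerSeries.coeff k (PowerSeries.C ((ϖ' : ℚ) : ℚ_[p]) * L')‖) → ∀ (S₀ : Finset (IsDedekindDomain.HeightOneSpectrum (NumberField.RingOfIntegers ℚ))), (∀ v ∈ S₀, Rat.HeightOneSpectrum.natGenerator v ≠ p) → (∀ v : IsDedekindDomain.HeightOneSpectrum (NumberField.RingOfIntegers ℚ), Rat.HeightOneSpectrum.natGenerator v ≠ p → Rat.HeightOneSpectrum.natGenerator v ∣ W.conductorNorm ℤ * W'.conductorNorm ℤ → v ∈ S₀) → ∃ u : ZMod p, u ≠ 0 ∧ ∀ j : ℕ, PowerSeries.coeff j (PowerSeries.map (PadicInt.toZMod (p := p)) (G * ∏ v ∈ S₀, Polynomial.aeval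 (PowerSeries.C ((Rat.HeightOneSpectrum.natGenerator v : ℤ_[p]).inv) * PowerSeries.binomialSeries ℤ_[p] (-(Literature.NumberTheory.EllipticCurves.GreenbergVatsal2000.frobeniusExponent p (Rat.HeightOneSpectrum.natGenerator v : ℤ_[p])))) (W.localPolynomialAt v))) = u * PowerSeries.coeff j (PowerSeries.map (PadicInt.toZMod (p := p)) (G' * ∏ v ∈ S₀, Polynomial.aeval (PowerSeries.C ((Rat.HeightOneSpectrum.natGenerator v : ℤ_[p]).inv) * PowerSeries.binomialSeries ℤ_[p] (-(Literature.NumberTheory.EllipticCurves.GreenbergVatsal2000.frobeniusExponent p (Rat.HeightOneSpectrum.natGenerator v : ℤ_[p])))) (W'.localPolynomialAt v)))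

-- item stmt-BirchSwinnertonDyer-24278 · aside · rank 9 · open · by planner — informal only, no Lean statement yet:
--   [aside] THEOREM B-PRIME, X2 form (lam-a MEMO-8/9/10 §2; OUR result on paper, PRE-grade; banked
--   context per planner RULING L100 (2): never staffed, not progress, not a binder of `closes`,
--   BC6-exempt, NOT a Literature fact, NOT a crux): for p ≠ 2, W multiplicative at p, (W, p, q) a Mazur
--   twin-family pair (`Theorems.EisensteinPrimesMazurTwinFamily.MazurTwinFamilyAt W p q`, defs landed
--   p589499) satisfying Mazur (G) (`MazurGoodAt p q`): mu_an = 0 and lambda_an = Sum over l in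
--   splitPrimesOutside W p q of sFactor p l — typed Prop (verified rc 0 against this route file`s
--   imports + p589499 in HOME/plan

-- item stmt-BirchSwinnertonDyer-24279 · aside · rank 9 · open · by planner — informal only, no Lean statement yet:
--   [aside] THEOREM B-PRIME, X1 form (good reduction at p; lam-a MEMO-8/9/10 §2; OUR result on paper,
--   PRE-grade; banked context per planner RULING L100 (2): never staffed, not progress, not a binder of
--   `closes`, BC6-exempt, NOT a Literature fact, NOT a crux): for p ≠ 2, W good at p, (W, p, q) a Mazur
--   twin-family pair (`Theorems.EisensteinPrimesMazurTwinFamily.MazurTwinFamilyAt W p q`, defs landed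
--   p589499) satisfying Mazur (G) (`MazurGoodAt p q`): mu_an = 0 and lambda_an = Sum over l in
--   splitPrimesOutside W p q of sFactor p l on the X1 side — typed Prop (verified rc 0 against this
--   route file`s impo

-- item stmt-BirchSwinnertonDyer-24799 · aside · rank 9 · open · by planner — informal only, no Lean statement yet:
--   [aside] THEOREM C^mix (lam-a MEMO-11 §3b COROLLARY, generic case S_E = {q₁} with Mazur (G); OUR
--   result on paper, referee g66 desk-read PASS; banked context per planner RULING L101 (ii): never
--   staffed, not progress, not a binder of `closes`, BC6-exempt, NOT a Literature fact, NOT a crux).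
--   Statement = the conjunction ThmCmixX2Sig ∧ ThmCmixX1Sig of `HOME/lam-a-g12/ThmCSig.lean` (sha16
--   7ec9e3188a954080; planner re-check 02:20Z: lean check rc 0 / 0 err / 0 sorry / 4 dupNamespace
--   warnings, against the route file`s imports + Theorems.EisensteinPrimesMazurTwinFamily p589499 +
--   Theorems.EisensteinPrimes

-- item stmt-BirchSwinnertonDyer-24800 · aside · rank 9 · open · by planner — informal only, no Lean statement yet:
--   [aside] THEOREM C^oth (p = 3; lam-a MEMO-11 §3c with Mazur (G), e₁ = 0; OUR result on paper, referee
--   g66 desk-read PASS; banked context per planner RULING L101 (ii): never staffed, not progress, not a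
--   binder of `closes`, BC6-exempt, NOT a Literature fact, NOT a crux). Statement = the conjunction
--   ThmCothX2Sig ∧ ThmCothX1Sig of `HOME/lam-a-g12/ThmCSig.lean` (sha16 7ec9e3188a954080; planner
--   re-check rc 0, see ThmCmix): for W multiplicative (X2 form) resp. good (X1 form) at 3 with ONE
--   Eisenstein-type support prime q₁ ≡ 1 (mod 9), 3 not a cube mod q₁ (`OneEisensteinFamilyAt W 3 q₁`,
--   `MazurGoodAt 3

/-- item stmt-BirchSwinnertonDyer-27407 · support · rank 9 · open · by planner
[support][conjecture] Vatsal, JIMJ 4 (2005) (doi 10.1017/S147474800500006X) Conj. 1.14(2) at r = 0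
(p. 10), Thm. 1.16 + status sentences p. 11 («it is not known that the lower bound … is actually
sharp»; «nothing is known when χ is even and χ ≠ 1»): the ANALYTIC μ-invariant of the p-stabilised
modular symbol / Mazur–Tate–Teitelbaum p-adic L-function of E₀ vanishes, μ_an(E₀, p) = 0, at every
X2b pair (analytic rank 0, p odd multiplicative, E[p] reducible) lying OFF the barrier locus
`Literature.Barriers.BirchSwinnertonDyer.HasRamifiedOddLineAt` (no ramified-odd rational p-line) =
the étale ends. TEXT = the expired mudescent v3 stub `stub_analyticMuZero_offLocus` (skeleton
5696c7c7…, expired 2026-08-28T07:17:38Z) VERBATIM up to `Iff.rfl`: the route file imports neither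
`Literature.Barriers.BirchSwinnertonDyer.EisensteinMuConjecture` (for `HasRamifiedOddLineAt`) nor
`Summits.BirchSwinnertonDyer.Rank1Residual.X2.AnalyticInvariants` (for `X2.AnalyticMuLE`), so both
are UNFOLDED by their definitions here (certified `Iff.rfl` both ways in the pen's Sketch2.lean,
farm rc 0; bare-route-context check Sketch3.lean rc 0). BRIDGE to mudescent v4 stub 3′
`stub_muPart_offLocus` is already kernel: -/
@[route_item "route-BirchSwinnertonDyer-EisensteinPrimes", crux]
def AnalyticMuZeroOffLocus : Prop :=
  ∀ (W₀ : WeierstrassCurve ℚ) [W₀.IsElliptic] [W₀.IsGloballyMinimal] (p : ℕ) [Fact p.Prime], Summit.BirchSwinnertonDyer.Rank1Residual.X2.CellB W₀ p → (¬ ∃ Φ : AddSubgroup (W₀.geomTorsion (p : ℤ)), Literature.NumberTheory.EllipticCurves.Rank1Residual.IsRationalLine W₀ p Φ ∧ ¬ Literature.NumberTheory.EllipticCurves.Rank1Residual.LineUnramifiedAt W₀ p Φ ∧ Literature.NumberTheory.EllipticCurves.Rank1Residual.LineOdd W₀ p Φ) → ∀ {N : ℕ} [NeZero N] (f : CuspForm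 (CongruenceSubgroup.Gamma0 N) 2), Literature.NumberTheory.EllipticCurves.ModularForms.IsNewformOf W₀ f → ∀ (ϖ : ℚ), (ϖ : ℝ) * W₀.realPeriodRat = Literature.NumberTheory.EllipticCurves.ModularForms.plusPeriod f → ∀ (L : PowerSeries ℚ_[p]), (W₀.HasSplitMultiplicativeReductionAtPrime p → Literature.NumberTheory.EllipticCurves.IsSplitMultPAdicLFunctionOf f p L) → (¬ W₀.HasSplitMultiplicativeReductionAtPrime p → Literature.NumberTheory.EllipticCurves.IsMultPAdicLFunctionOf f p (-1) L) → ∃ k : ℕ, (p : ℝ) ^ (-(((0 : ℕ) : ℤ) + 1)) < ‖PowerSeries.coeff k (PowerSeries.C ((ϖ : ℚ) : ℚ_[p]) * L)‖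

/-- item stmt-BirchSwinnertonDyer-27489 · support · rank 9 · open · by operator
sources: KellerYin2024, Castella2018, CastellaEtAl2021, CastellaGrossiLeeSkinner2022, JetchevSkinnerWan2017, GrossZagier1986
[support][conjecture/PRE] The Heegner-index identity over K at p ∥ N with r_an(E/K) = 1 in BOTH rank
orientations (hypothesis `W.analyticRank + (W.quadraticTwist d_K).analyticRank = 1`): E/ℚ globally
minimal of conductor N, p ≠ 2 of multiplicative reduction, E[p] reducible, K imaginary quadratic
with d_K odd < −4 and the Heegner hypothesis for N, a modular parametrisation datum Dt with p ∤
c(Dt), P ∈ E(K) mapping to the Heegner point, Ш(E/K) finite ⟹ `X11b.IndexIdentityAt W p K P`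
(2·ord_p ∏c_q(E) + ord_p #Ш(E/K) = 2·ord_p [E(K) : ℤP], the p-part of the Gross–Zagier–Kolyvagin /
BDP index formula). ROLE (route-structure note, rev 19; director-bsd g13 (170′)(e′), eis RECORD #26,
referee g85 PASS): the ONE display modulo which cruxes #3 MazurMCOnCellB and #4 BSDpOnCellC are
EQUIVALENT — kernel
`…Theorems.EisensteinPrimesMazurMCOnCellBTwistbackDisplay.mazurMCOnCellB_iff_bsdpOnCellC_of_indexIdentities`
(p623836 §3) with hHI1 := the r_an(E) = 1 orientation = crux 4's typed input
`X2.HeegnerIndexIdentity` (road B11) and hHI0 := the r_an(E) = 0 orientation (twist-back road to row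
A10); both projections fact-free, converse given entire L-functions (pen Sketch5.lean
`hi1_of_kRankOne` / `hi0_ -/
@[route_item "route-BirchSwinnertonDyer-EisensteinPrimes"]
def HeegnerIndexIdentityKRankOne : Prop :=
  ∀ (W : WeierstrassCurve ℚ) [W.IsElliptic] [W.IsGloballyMinimal] (p : ℕ) [Fact p.Prime] (N : ℕ) [NeZero N] (K : Type) [Field K] [NumberField K] (Dt : Literature.NumberTheory.EllipticCurves.ModularForms.ModularParametrizationData W N) (H : Literature.NumberTheory.EllipticCurves.HeegnerDatum N (NumberField.discr K)) (ι : K →+* ℂ) (P : (W.baseChange K).toAffine.Point), p ≠ 2 → W.HasMultiplicativeReductionAtPrime p → ¬ W.HasIrreducibleModPGaloisRep p → W.analyticRank + (W.quadraticTwist (NumberField.discr K : ℚ)).analyticRank = 1 → W.conductorNorm ℤ = N → Literature.NumberTheory.EllipticCurves.IsImaginaryQuadratic K → Odd (NumberField.discr K) → NumberField.discr K < -4 → Literature.NumberTheory.EllipticCurves.SatisfiesHeegnerHypothesis N K → WeierstrassCurve.Affine.Point.map ι.toRatAlgHom P = Literature.NumberTheory.EllipticCurves.ModularForms.heegnerPointComplex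 Dt H → ¬ (p : ℤ) ∣ Dt.c → Finite (W.baseChange K).sha → Summit.BirchSwinnertonDyer.Rank1Residual.X11b.IndexIdentityAt W p K P

/-- item stmt-BirchSwinnertonDyer-27490 · support · rank 9 · open · by operator
sources: Schneider1985, SteinWuthrich2013, Disegni2020, Bertrand1982, MazurTateTeitelbaum1986Invent
[support][conjecture] The X2 twin of crux 6 SchneiderOnX1TypeB: Schneider's conjecture —
non-vanishing of the canonical cyclotomic p-adic regulator (`WeierstrassCurve.SchneiderConjecture
Dh`) — at every X2c ∩ GVPar pair (E[p] reducible, p ∥ N, analytic rank 1, Greenberg–Vatsal parity)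
for the CANONICAL multiplicative p-adic heights of Stein–Wuthrich 2013 §4.2: non-split sign
(`X2.CellCNonsplitGV`) for every height datum that `IsMultCanonical` w.r.t. a Tate parameter q with
j(q) = j(E), split sign (`X2.CellCSplitGV`) for every datum that `IsSplitMultCanonical` w.r.t. a
Tate-parameter datum; binder for binder the hypotheses hSchN ∧ hSchS of
`…Theorems.EisensteinPrimesMazurMCOnCellBTwistback.mazurMCOnCellB_of_rankZeroDisplay_of_schneider_of_exceptionalLeadingTerm`
(p623232). ROLE (route-structure note, rev 19): the display-free remainder of crux 3 on the
twist-back road — with Disegni 2020 Thm 4 (first clause), PublishedInputs and the split exceptional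
leading term `X2.O9.ExceptionalLeadingTermAt` it gives BSDp on X2c ∩ GVPar through the O9 closers
`X2.bsdp_of_cellC_of_not_split_of_gvPar_of_schneider` /
`X2.bsdp_of_cellC_of_split_of_gvPar_of_exceptionalLeadingTerm` (pen Sketch5.lean ` -/
@[route_item "route-BirchSwinnertonDyer-EisensteinPrimes"]
def SchneiderOnX2CellCGV : Prop :=
  (∀ (V : WeierstrassCurve ℚ) [V.IsElliptic] [V.IsGloballyMinimal] (ℓ : ℕ) [Fact ℓ.Prime], Summit.BirchSwinnertonDyer.Rank1Residual.X2.CellCNonsplitGV V ℓ → ∀ (q : ℚ_[ℓ]) (Dh : WeierstrassCurve.PAdicHeightData V ℓ), q ≠ 0 → ‖q‖ < 1 → Literature.NumberTheory.EllipticCurves.tateJ q = (V.j : ℚ_[ℓ]) → Literature.NumberTheory.EllipticCurves.SteinWuthrich2013.IsMultCanonical Dh q → WeierstrassCurve.SchneiderConjecture Dh) ∧ (∀ (V : WeierstrassCurve ℚ) [V.IsElliptic] [V.IsGloballyMinimal] (ℓ : ℕ) [Fact ℓ.Prime], Summit.BirchSwinnertonDyer.Rank1Residual.X2.CellCSplitGV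 V ℓ → ∀ (Dq : WeierstrassCurve.TateParameterData V ℓ) (Dh : WeierstrassCurve.PAdicHeightData V ℓ), Literature.NumberTheory.EllipticCurves.SteinWuthrich2013.IsSplitMultCanonical Dh Dq → WeierstrassCurve.SchneiderConjecture Dh)

/-- item stmt-BirchSwinnertonDyer-19038 · assembly · rank 1 · closed · proved by Summit.BirchSwinnertonDyer.BirchSwinnertonDyer.Theorems.eisensteinPrimes_assembly_proof @ 53ba793c9235 (prover) · by planner
sources: Miller2011LMS, KellerYin2024, GreenbergVatsal2000
[assembly] GoodLatticeBDPValue → MazurMCOnCellB → BSDpOnCellC → MazurMCOnX1RankZero →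
SchneiderOnX1TypeB → PublishedInputs → EisensteinPrimes (the rung-K5 leaf) -/
@[route_item "route-BirchSwinnertonDyer-EisensteinPrimes", crux]
def Assembly : Prop :=
  GoodLatticeBDPValue → MazurMCOnCellB → BSDpOnCellC → MazurMCOnX1RankZero → SchneiderOnX1TypeB → PublishedInputs → Summit.BirchSwinnertonDyer.Rank1Residual.Eisenstein.EisensteinPrimes

-- `Assembly` holds: proved by `Summit.BirchSwinnertonDyer.BirchSwinnertonDyer.Theorems.eisensteinPrimes_assembly_proof` @ 53ba793c9235 (its module imports this route file, so no `_holds` link can be stated here).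

/-! D-0027 §2.1 — DECIDING THEOREM (planner-authored via `route open/edit --closes-file`; by operator:999:1989709 2026-08-26T01:10:44Z):
its hypotheses are this route's items and its conclusion the registered leaf `Summit.BirchSwinnertonDyer.Rank1Residual.Eisenstein.EisensteinPrimes` (rung K5, D-0061) (glue_lint), and it elaborates with this file. -/

@[closes "route-BirchSwinnertonDyer-EisensteinPrimes"] theorem closes (hAsm : Assembly) (h1 : GoodLatticeBDPValue) (h2 : MazurMCOnCellB) (h3 : BSDpOnCellC)
    (h4 : MazurMCOnX1RankZero) (h5 : SchneiderOnX1TypeB) (hP : PublishedInputs) :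
    Summit.BirchSwinnertonDyer.Rank1Residual.Eisenstein.EisensteinPrimes := by
  -- `Assembly` (the route's join: the five open inputs and the published-fact bundle imply the
  -- rung-K5 leaf) is itself an item, proved on the Theorems side by the kernel certificate
  -- `Theorems.EisensteinPrimesInputs.eisensteinPrimes_of_inputs[_of_targetC]` (p405443 / p405898);
  -- the deciding theorem is its application, so every declared item is load-bearing.
  unfold Assembly at hAsm
  exact hAsm h1 h2 h3 h4 h5 hP

end Summit.BirchSwinnertonDyer.BirchSwinnertonDyer.Theses.EisensteinPrimes
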